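import Mathlib
import Literature.Probability.PointProcesses.LensConsistentLaw
import Literature.MathematicalPhysics.StatisticalMechanics.LennardJonesClusters
import HarnessLib

/-!
# Crux `PatternPricedCertificates` (stmt-AtomisticToContinuum-12974), line `registered`: stub `stub_boxIntegral_faceCrossing`

Volume of the box `[0,s)³` and the face-crossing bound: the offsets `u` for which a point `z` and the
origin lie in different cubes of `sℤ³ + u` have volume `≤ s²(|z₀|+|z₁|+|z₂|)`. Helper for
`stub_unpricedMeanBound` (shift-averaged cube transport).
-/

noncomputable section

open scoped BigOperators Classical
open MeasureTheory

namespace Summit.AtomisticToContinuum.Crystallization.Theorems.PatternPricedCertificates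

/-- One-dimensional face crossing: if an offset `t ∈ [0,s)` puts `a` and `0` into different cells of
`sℤ + t`, i.e. `⌊(a - t)/s⌋ ≠ ⌊(0 - t)/s⌋`, then `t = 0`, or `t ∈ [0, a]`, or `t ∈ [a + s, s]`
(a set of length `≤ |a|`). [folklore] -/
theorem faceCrossing_mem_of_floor_ne {s : ℝ} (hs : 0 < s) {a t : ℝ} (ht0 : 0 ≤ t) (hts : t < s)
    (h : ⌊(a - t) / s⌋ ≠ ⌊(0 - t) / s⌋) :
    t ∈ ({0} ∪ Set.Icc 0 a ∪ Set.Icc (a + s) s : Set ℝ) := by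
  simp only [Set.mem_union, Set.mem_singleton_iff, Set.mem_Icc]
  rcases ht0.eq_or_lt with h0 | h0
  · exact Or.inl (Or.inl h0.symm)
  · have hfl : ⌊(0 - t) / s⌋ = -1 := by
      rw [Int.floor_eq_iff]
      push_cast
      constructor
      · rw [le_div_iff₀ hs]; linarith
      · rw [div_lt_iff₀ hs]; linarith
    have key : ¬ (-s ≤ a - t ∧ a - t < 0) := by
      rintro ⟨h1, h2⟩
      apply h
      rw [hfl, Int.floor_eq_iff]
      push_cast
      constructor
      · rw [le_div_iff₀ hs]; linarith
      · rw [div_lt_iff₀ hs]; linarith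
    by_cases hle : t ≤ a
    · exact Or.inl (Or.inr ⟨ht0, hle⟩)
    · rcases le_or_gt (a + s) t with hc | hc
      · exact Or.inr ⟨hc, hts.le⟩
      · exact absurd ⟨by linarith, by linarith [not_le.mp hle]⟩ key

/-- The one-dimensional bad set `{0} ∪ [0, a] ∪ [a + s, s]` has Lebesgue measure `≤ |a|`.
[folklore] -/
theorem volume_faceCrossing_interval_le (s a : ℝ) :
    volume ({0} ∪ Set.Icc 0 a ∪ Set.Icc (a + s) s : Set ℝ) ≤ ENNReal.ofReal |a| := by
  calc volume ({0} ∪ Set.Icc 0 a ∪ Set.Icc (a + s) s : Set ℝ)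
      ≤ volume ({0} ∪ Set.Icc 0 a : Set ℝ) + volume (Set.Icc (a + s) s) := measure_union_le _ _
    _ ≤ (volume ({0} : Set ℝ) + volume (Set.Icc 0 a)) + volume (Set.Icc (a + s) s) := by
        gcongr; exact measure_union_le _ _
    _ = ENNReal.ofReal |a| := by
        rw [Real.volume_singleton, Real.volume_Icc, Real.volume_Icc, zero_add, sub_zero,
          show s - (a + s) = -a by ring]
        rcases le_or_gt 0 a with h | h
        · rw [ENNReal.ofReal_of_nonpos (neg_nonpos.2 h), add_zero, abs_of_nonneg h]
        · rw [ENNReal.ofReal_of_nonpos h.le, zero_add, abs_of_neg h]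

/-- Volume of the coordinate slab of the box `[0,s)³` whose `i`-th side is replaced by the
one-dimensional bad set of `a`: it is at most `s² |a|`. [folklore] -/
theorem volume_faceCrossing_slab_le {s : ℝ} (hs : 0 < s) (a : ℝ) (i : Fin 3) :
    volume (Set.pi Set.univ (fun j : Fin 3 =>
        if j = i then ({0} ∪ Set.Icc 0 a ∪ Set.Icc (a + s) s : Set ℝ) else Set.Ico 0 s)) ≤
      ENNReal.ofReal (s ^ 2 * |a|) := by
  have hI : volume (Set.Ico (0 : ℝ) s) = ENNReal.ofReal s := by rw [Real.volume_Ico, sub_zero]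
  have hJ := volume_faceCrossing_interval_le s a
  have hprod : volume (Set.pi Set.univ (fun j : Fin 3 =>
        if j = i then ({0} ∪ Set.Icc 0 a ∪ Set.Icc (a + s) s : Set ℝ) else Set.Ico 0 s)) =
      volume ({0} ∪ Set.Icc 0 a ∪ Set.Icc (a + s) s : Set ℝ) * ENNReal.ofReal s ^ 2 := by
    rw [volume_pi_pi, Fin.prod_univ_three]
    fin_cases i <;> simp [hI] <;> ring
  rw [hprod, mul_comm (s ^ 2), ENNReal.ofReal_mul (abs_nonneg a), ENNReal.ofReal_pow hs.le]
  gcongr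

/-- **Stub A2 (box volume and the face-crossing bound).** The box `[0,s)³` has volume `s³`, and for a
point `z` of `ℝ³` the set of offsets `u ∈ [0,s)³` for which `z` and `0` lie in different cubes of the
partition `sℤ³ + u` (i.e. `⌊(z_i − u_i)/s⌋ ≠ ⌊(0 − u_i)/s⌋` for some `i`) has volume
`≤ s² (|z₀| + |z₁| + |z₂|)` (union bound over the three coordinates; in coordinate `i` the bad
offsets form an interval of length `min(|z_i|, s)`). [folklore] -/
theorem stub_boxIntegral_faceCrossing :
    ∀ (s : ℝ), 0 < s →
      MeasureTheory.volume (Set.pi Set.univ (fun _ : Fin 3 => Set.Ico (0 : ℝ) s)) = ENNReal.ofReal (s ^ 3) ∧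
      ∀ z : EuclideanSpace ℝ (Fin 3),
        ∫ u in Set.pi Set.univ (fun _ : Fin 3 => Set.Ico (0 : ℝ) s),
            (if (∀ i : Fin 3, ⌊(z i - u i) / s⌋ = ⌊(0 - u i) / s⌋) then (0 : ℝ) else 1) ≤
          s ^ 2 * (|z 0| + |z 1| + |z 2|) := by
  intro s hs
  have hB : MeasureTheory.volume (Set.pi Set.univ (fun _ : Fin 3 => Set.Ico (0 : ℝ) s)) =
      ENNReal.ofReal (s ^ 3) := by
    rw [Real.volume_pi_Ico, ENNReal.ofReal_pow hs.le]
    simp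
  refine ⟨hB, fun z => ?_⟩
  have hBmeas : MeasurableSet (Set.pi Set.univ (fun _ : Fin 3 => Set.Ico (0 : ℝ) s)) :=
    MeasurableSet.univ_pi (fun _ => measurableSet_Ico)
  haveI : IsFiniteMeasure (volume.restrict (Set.pi Set.univ (fun _ : Fin 3 => Set.Ico (0 : ℝ) s))) := by
    rw [isFiniteMeasure_restrict, hB]
    exact ENNReal.ofReal_ne_top
  -- the coordinate slabs
  set S : Fin 3 → Set (Fin 3 → ℝ) := fun i => Set.pi Set.univ (fun j : Fin 3 =>
    if j = i then ({0} ∪ Set.Icc 0 (z i) ∪ Set.Icc (z i + s) s : Set ℝ) else Set.Ico 0 s) with hSdef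
  have hSmeas : ∀ i, MeasurableSet (S i) := by
    intro i
    refine MeasurableSet.univ_pi (fun j => ?_)
    dsimp only
    split_ifs
    · exact ((measurableSet_singleton 0).union measurableSet_Icc).union measurableSet_Icc
    · exact measurableSet_Ico
  have hSvol : ∀ i, volume (S i) ≤ ENNReal.ofReal (s ^ 2 * |z i|) := fun i =>
    volume_faceCrossing_slab_le hs (z i) i
  have hint : ∀ i, Integrable ((S i).indicator (fun _ => (1 : ℝ)))
      (volume.restrict (Set.pi Set.univ (fun _ : Fin 3 => Set.Ico (0 : ℝ) s))) := fun i =>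
    (integrable_const (1 : ℝ)).indicator (hSmeas i)
  calc ∫ u in Set.pi Set.univ (fun _ : Fin 3 => Set.Ico (0 : ℝ) s),
            (if (∀ i : Fin 3, ⌊(z i - u i) / s⌋ = ⌊(0 - u i) / s⌋) then (0 : ℝ) else 1)
      ≤ ∫ u in Set.pi Set.univ (fun _ : Fin 3 => Set.Ico (0 : ℝ) s),
            ∑ i : Fin 3, (S i).indicator (fun _ => (1 : ℝ)) u := by
        apply integral_mono_of_nonneg
        · exact Filter.Eventually.of_forall (fun u => by
            simp only [Pi.zero_apply]; split_ifs <;> norm_num)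
        · exact integrable_finsetSum _ (fun i _ => hint i)
        · apply ae_restrict_of_forall_mem hBmeas
          intro u hu
          rw [Set.mem_univ_pi] at hu
          dsimp only
          split_ifs with hall
          · exact Finset.sum_nonneg (fun i _ => Set.indicator_nonneg (fun _ _ => zero_le_one) _)
          · simp only [not_forall] at hall
            obtain ⟨i, hi⟩ := hall
            have hui : u ∈ S i := by
              rw [hSdef, Set.mem_univ_pi]
              intro j
              by_cases hji : j = i
              · subst hji
                rw [if_pos rfl]
                exact faceCrossing_mem_of_floor_ne hs (hu j).1 (hu j).2 hi
              · rw [if_neg hji]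
                exact hu j
            calc (1 : ℝ) = (S i).indicator (fun _ => (1 : ℝ)) u := by rw [Set.indicator_of_mem hui]
              _ ≤ ∑ j : Fin 3, (S j).indicator (fun _ => (1 : ℝ)) u :=
                Finset.single_le_sum (f := fun j => (S j).indicator (fun _ => (1 : ℝ)) u)
                  (fun j _ => Set.indicator_nonneg (fun _ _ => zero_le_one) _) (Finset.mem_univ i)
    _ = ∑ i : Fin 3, ∫ u in Set.pi Set.univ (fun _ : Fin 3 => Set.Ico (0 : ℝ) s),
            (S i).indicator (fun _ => (1 : ℝ)) u := integral_finsetSum _ (fun i _ => hint i)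
    _ = ∑ i : Fin 3,
          (volume.restrict (Set.pi Set.univ (fun _ : Fin 3 => Set.Ico (0 : ℝ) s))).real (S i) := by
        refine Finset.sum_congr rfl (fun i _ => ?_)
        rw [integral_indicator_const _ (hSmeas i), smul_eq_mul, mul_one]
    _ ≤ ∑ i : Fin 3, s ^ 2 * |z i| := by
        refine Finset.sum_le_sum (fun i _ => ?_)
        refine ENNReal.toReal_le_of_le_ofReal (by positivity) ?_
        exact (Measure.restrict_apply_le _ _).trans (hSvol i)
    _ = s ^ 2 * (|z 0| + |z 1| + |z 2|) := by
        rw [Fin.sum_univ_three]; ring
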